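import Summits.MatrixMultiplication.OmegaCensus.SmallFormats.InvertiblePointDeltaLawThree
import Summits.MatrixMultiplication.OmegaCensus.SmallFormats.InvertiblePointDeltaLawPrep
import Summits.MatrixMultiplication.OmegaCensus.SmallFormats.MatMul225GF3CensusReduction
import HarnessLib

/-!
# ω-census family (a): the δ-law, third form — four points of `P¹(k)` (e.g. `𝔽₃`) and the census consequences

Cell `pub-omega` (unit `pub-omega-tensor`, gen 34), topic `Summits/MatrixMultiplication/OmegaCensus` (sub-folder
`SmallFormats`). Framing (verbatim): lottery ticket; floor = certified bounds/negative ranges. HONEST FRAMING: corollaries of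
`InvertiblePointDeltaLawThree`. Over a field with an element `a ∉ {0, 1}` (every field except `𝔽₂`; `𝔽₃` with `a = 2`) the four
vectors `(1,0), (0,1), (1,1), (1,a)` are pairwise independent, so the third form applies with `P = 3`:
* `seven_mul_le_or_of_saturated_one_of_ne` / `…_of_saturated_of_ne` (any invertible `X₀`): a saturated invertible point forces
  `7n ≤ 2r ∨ (10n + 3 ≤ 3r ∧ 3n + 4 ≤ r)`;
* `two_mul_add_one_le_card_filter_ne_of_ne`: if `2r < 7n` and `3r < 10n + 3`, at every invertible `X₀` at least `2n + 1` X-forms are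
  nonzero — NO saturated invertible point. Instances over such fields: 24-term `⟨2,2,7⟩` (`fifteen_le_card_filter_ne_227_24`),
  30-term `⟨2,2,9⟩`, 34-term `⟨2,2,10⟩`, 37-term `⟨2,2,11⟩` (`…_229_30`, `…_2210_34`, `…_2211_37`).
For `𝔽₃`: `two_ne_zero_zmod3`, `two_ne_one_zmod3`. Nothing here is a bound on `ω`; none of these instances is a rank statement.
-/

namespace Summit.MatrixMultiplication.OmegaCensus.SmallFormats

open Module Matrix Literature.Computability.AlgebraicComplexity
open Summit.MatrixMultiplication.OmegaCensus.RankOnePlaneCapGeneral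

namespace DeltaLaw

variable {k : Type*} [Field k] {n : ℕ} {ι : Type*} [Fintype ι] [DecidableEq ι]

/-- The four vectors `(1,0), (0,1), (1,1), (1,a)`. -/
def fourPoints (a : k) : Fin 4 → (Fin 2 → k) := ![![1, 0], ![0, 1], ![1, 1], ![1, a]]

/-- They are pairwise independent when `a ≠ 0, 1`. -/
theorem fourPoints_pairwise {a : k} (ha0 : a ≠ 0) (ha1 : a ≠ 1) :
    ∀ i j : Fin 4, i ≠ j → fourPoints a i 0 * fourPoints a j 1 - fourPoints a i 1 * fourPoints a j 0 ≠ 0 := by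
  have ha1' : a - 1 ≠ 0 := sub_ne_zero.mpr ha1
  have ha1'' : 1 - a ≠ 0 := sub_ne_zero.mpr (Ne.symm ha1)
  intro i j hij
  fin_cases i <;> fin_cases j <;> simp_all [fourPoints]

/-- **δ-law, third form with `P = 3`** (field with some `a ∉ {0,1}`), at `X₀ = 1`. -/
theorem seven_mul_le_or_of_saturated_one_of_ne {a : k} (ha0 : a ≠ 0) (ha1 : a ≠ 1)
    (β : BilinComp (mulBilin k 2 2 n) ι) (O : Finset ι)
    (hO : ∀ i, i ∉ O → β.f i 1 = 0) (hO' : ∀ i ∈ O, β.f i 1 ≠ 0) (hcard : O.card = 2 * n) :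
    7 * n ≤ 2 * Fintype.card ι ∨ (10 * n + 3 ≤ 3 * Fintype.card ι ∧ 3 * n + 4 ≤ Fintype.card ι) :=
  seven_mul_le_or_of_saturated_one 3 (fourPoints a) (fourPoints_pairwise ha0 ha1) β O hO hO' hcard

section Census

variable [DecidableEq k]

/-- **δ-law, third form with `P = 3`, at any invertible point.** -/
theorem seven_mul_le_or_of_saturated_of_ne {a : k} (ha0 : a ≠ 0) (ha1 : a ≠ 1)
    (β : BilinComp (mulBilin k 2 2 n) ι) (X₀ : Matrix (Fin 2) (Fin 2) k) (hX₀ : IsUnit X₀.det)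
    (hsat : (Finset.univ.filter fun i => β.f i X₀ ≠ 0).card = 2 * n) :
    7 * n ≤ 2 * Fintype.card ι ∨ (10 * n + 3 ≤ 3 * Fintype.card ι ∧ 3 * n + 4 ≤ Fintype.card ι) := by
  classical
  obtain ⟨β', hf, -, -⟩ := exists_XsideTransform β X₀ X₀⁻¹ 1 1 (Matrix.mul_nonsing_inv X₀ hX₀) (Matrix.one_mul 1)
  have hf1 : ∀ i, β'.f i 1 = β.f i X₀ := fun i => by rw [hf, Matrix.mul_one, Matrix.mul_one]
  refine seven_mul_le_or_of_saturated_one_of_ne ha0 ha1 β' (Finset.univ.filter fun i => β.f i X₀ ≠ 0) ?_ ?_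
    (by convert hsat)
  · intro i hi
    rw [hf1]
    by_contra h
    exact hi (Finset.mem_filter.mpr ⟨Finset.mem_univ i, h⟩)
  · intro i hi
    rw [hf1]
    exact (Finset.mem_filter.mp hi).2

/-- **Census form (`P = 3`):** if `2r < 7n` and `3r < 10n + 3` then NO invertible point is saturated: at least `2n + 1` X-forms are
nonzero at every invertible `X₀`. -/
theorem two_mul_add_one_le_card_filter_ne_of_ne {a : k} (ha0 : a ≠ 0) (ha1 : a ≠ 1)
    (β : BilinComp (mulBilin k 2 2 n) ι) (h7 : 2 * Fintype.card ι < 7 * n) (h10 : 3 * Fintype.card ι < 10 * n + 3)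
    (X₀ : Matrix (Fin 2) (Fin 2) k) (hX₀ : IsUnit X₀.det) :
    2 * n + 1 ≤ (Finset.univ.filter fun i => β.f i X₀ ≠ 0).card := by
  have h1 : 2 * n ≤ (Finset.univ.filter fun i => β.f i X₀ ≠ 0).card := by
    convert two_mul_le_card_filter_ne β X₀ hX₀
  rcases Nat.lt_or_ge (2 * n) (Finset.univ.filter fun i => β.f i X₀ ≠ 0).card with h | h
  · exact h
  · have heq : (Finset.univ.filter fun i => β.f i X₀ ≠ 0).card = 2 * n := le_antisymm h h1
    rcases seven_mul_le_or_of_saturated_of_ne ha0 ha1 β X₀ hX₀ heq with h' | ⟨h', -⟩ <;> omega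

/-- **24-term `⟨2,2,7⟩`** (field with `a ∉ {0,1}`, e.g. `𝔽₃`): at every invertible point at least 15 of the 24 X-forms are
nonzero — no saturated invertible point (`2·24 < 49`, `3·24 < 73`). -/
theorem fifteen_le_card_filter_ne_227_24 {a : k} (ha0 : a ≠ 0) (ha1 : a ≠ 1) (β : BilinComp (mulBilin k 2 2 7) ι)
    (hι : Fintype.card ι = 24) (X₀ : Matrix (Fin 2) (Fin 2) k) (hX₀ : IsUnit X₀.det) :
    15 ≤ (Finset.univ.filter fun i => β.f i X₀ ≠ 0).card :=
  two_mul_add_one_le_card_filter_ne_of_ne ha0 ha1 β (by rw [hι]; norm_num) (by rw [hι]; norm_num) X₀ hX₀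

/-- **30-term `⟨2,2,9⟩`**: at least 19 of the 30 X-forms are nonzero at every invertible point. -/
theorem nineteen_le_card_filter_ne_229_30 {a : k} (ha0 : a ≠ 0) (ha1 : a ≠ 1) (β : BilinComp (mulBilin k 2 2 9) ι)
    (hι : Fintype.card ι = 30) (X₀ : Matrix (Fin 2) (Fin 2) k) (hX₀ : IsUnit X₀.det) :
    19 ≤ (Finset.univ.filter fun i => β.f i X₀ ≠ 0).card :=
  two_mul_add_one_le_card_filter_ne_of_ne ha0 ha1 β (by rw [hι]; norm_num) (by rw [hι]; norm_num) X₀ hX₀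

/-- **34-term `⟨2,2,10⟩`**: at least 21 of the 34 X-forms are nonzero at every invertible point. -/
theorem twentyone_le_card_filter_ne_2210_34 {a : k} (ha0 : a ≠ 0) (ha1 : a ≠ 1)
    (β : BilinComp (mulBilin k 2 2 10) ι) (hι : Fintype.card ι = 34) (X₀ : Matrix (Fin 2) (Fin 2) k)
    (hX₀ : IsUnit X₀.det) : 21 ≤ (Finset.univ.filter fun i => β.f i X₀ ≠ 0).card :=
  two_mul_add_one_le_card_filter_ne_of_ne ha0 ha1 β (by rw [hι]; norm_num) (by rw [hι]; norm_num) X₀ hX₀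

/-- **37-term `⟨2,2,11⟩`**: at least 23 of the 37 X-forms are nonzero at every invertible point. -/
theorem twentythree_le_card_filter_ne_2211_37 {a : k} (ha0 : a ≠ 0) (ha1 : a ≠ 1)
    (β : BilinComp (mulBilin k 2 2 11) ι) (hι : Fintype.card ι = 37) (X₀ : Matrix (Fin 2) (Fin 2) k)
    (hX₀ : IsUnit X₀.det) : 23 ≤ (Finset.univ.filter fun i => β.f i X₀ ≠ 0).card :=
  two_mul_add_one_le_card_filter_ne_of_ne ha0 ha1 β (by rw [hι]; norm_num) (by rw [hι]; norm_num) X₀ hX₀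

end Census

/-- `(2 : 𝔽₃) ≠ 0`. -/
theorem two_ne_zero_zmod3 : (2 : ZMod 3) ≠ 0 := by decide

/-- `(2 : 𝔽₃) ≠ 1`. -/
theorem two_ne_one_zmod3 : (2 : ZMod 3) ≠ 1 := by decide

/-- **Over `𝔽₃`: no 24-term scheme for `⟨2,2,7⟩` has a saturated invertible point** (at most 9 of 24 X-forms vanish at any
invertible `X₀`; the cap alone allows 10). -/
theorem fifteen_le_card_filter_ne_227_24_gf3 {ι : Type*} [Fintype ι] [DecidableEq ι]
    (β : BilinComp (mulBilin (ZMod 3) 2 2 7) ι) (hι : Fintype.card ι = 24) (X₀ : Matrix (Fin 2) (Fin 2) (ZMod 3))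
    (hX₀ : IsUnit X₀.det) : 15 ≤ (Finset.univ.filter fun i => β.f i X₀ ≠ 0).card :=
  fifteen_le_card_filter_ne_227_24 two_ne_zero_zmod3 two_ne_one_zmod3 β hι X₀ hX₀

end DeltaLaw

end Summit.MatrixMultiplication.OmegaCensus.SmallFormats
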